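import Summits.QuantumFields.BalabanUV.Beta.GAN24.Lin4LegTowerTwo
import Summits.QuantumFields.BalabanUV.Beta.GAN24.BiTableParityHalves

/-!
# `BalabanUV.Beta.GAN24.LegLetterParity` — binder row G-an2-4 ∕ (CONV-C), W-slot, the (α-0) parity re-cut, row L11 (Q-L): **THE LEG LETTER ROWS VERSUS
# `rdiv` ∕ `ldiv`, AND «ONE LEG TOWER PER PARITY MEMBER»** — the letter-row lambdas of FILE 3c `T2ShapeEvenMemberOfWardLetters` (`hL₁ hL₂`) are `−ldiv` ∕ `−rdiv`
# of MY g60 `Lin4LegTower{,Two}`; `LocStencil₂` is sign-blind; and for a PARITY MEMBER `P (Y s) = ε • Y s` (`P := sgnK ∘ trK`, `|ε| ≤ 1`) the LEFT-leg letter is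
# the signed leg-transpose of the RIGHT-leg letter, so **`hL₁ ⟸ hL₂` with the SAME `(C, δ)`** — the OWNER gan24-p1 g33's RULING R-gan24p1-g33-2 (4)-2 «`P ∘ rdiv =
# ldivᵀ ∘ P`» typed exactly as far as the letter rows use it (G-an2-4 formalisation swarm, leaf prover `b2b-balaban-gan24-formalise-leaf-03`, gen 67; FILE 2 of the
# journal INTENT [LEAF03-G67-ONLINE] «(Q-L) LETTER ROWS ⟸ THE RULED DISPLAY»)

NOT IN PRINT; OUR BOOKKEEPING ([folklore] finite-sum and sign algebra; 0 `def`, 0 cited facts, 0 `def … : Prop`, 0 sorry).  HONEST FRAMING (cell contract,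
verbatim): «discharging `BetaPertH` makes Bałaban's UV stability UNCONDITIONAL — a real constructive-QFT result; it is NOT the continuum limit and NOT the Clay
problem.»  HONEST DEPENDENCY (verbatim): «continuum YM on T⁴ ⇐ BetaPertH ∧ nine spine estimates (0/9 proved); BetaPertH ⇐ (D1) ∧ (D4) ∧ CAP+tail; G-an2-4
gates asym, D1 and NE2/3/4.»

WHAT (generic `d`; `Y` any bi-table; the letter lambdas are leaf-02's ∕ MY g66 FILE 1's, VERBATIM — with an1's `AffineAveraging.unitVec` as the consumers spell them,
bridged to an2's `B6BondElimination.unitVec` of `rdiv ∕ ldiv` by `AveragingWardStencils.b6UnitVec_eq`).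
* §1 `legLetterR_eq_neg_rdiv` — `(fun s ↦ (x p a _ ↦ Σ_β (Y s x p a (inl β) − Y s x (p − e_β) a (inl β)))) = −(fun s ↦ rdiv (Y s))`;
  `legLetterL_eq_neg_ldiv` — `(fun s ↦ (p z _ b ↦ Σ_β (Y s p z (inl β) b − Y s (p − e_β) z (inl β) b))) = −(fun s ↦ ldiv (Y s))`.
* §2 `locStencil₂_neg`, `locStencil₂_neg_iff` — `LocStencil₂` is sign-blind; `legRowR_iff_rdiv`, `legRowL_iff_ldiv` — the letter rows ARE `LocStencil₂` rows of
  `rdiv ∘ Y` ∕ `ldiv ∘ Y` with the same constants.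
* §3 `rdiv_sgnK` (`rdiv (sgnK F) x p a b = sgnF a · rdiv F x p a b`: the contracted field index carries sign `+1`), **`ldiv_of_parity`** — if `sgnK (trK F) = ε • F`
  then `ldiv F x p a b = ε · sgnF b · rdiv F p x b a` —, `abs_ldiv_le_of_parity` (`|ε| ≤ 1`), **`locStencil₂_ldiv_of_parity`** — for a parity family
  `∀ s, sgnK (trK (Y s)) = ε • Y s`, `LocStencil₂ (rdiv ∘ Y) C δ ⟹ LocStencil₂ (ldiv ∘ Y) C δ` (the `LocStencil₂` weight is leg-symmetric).
* §4 `parity_halfTable` — the `ε`-member `½ • (X + ε • P X)` (`ε·ε = 1`: even `ε = 1`, odd `ε = −1`) IS a parity family with sign `ε`; **`legRowL_of_legRowR_half`**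
  — THE ECONOMY: for `y := ½ • (X + ε • P X)`, the RIGHT-leg letter row `hL₂` (constant `C`, rate `δ`) ⟹ the LEFT-leg letter row `hL₁` (SAME `C`, `δ`), in FILE
  3c's EXACT lambda spellings; `legRows_of_rdiv_half` — both letter rows from ONE `LocStencil₂ (rdiv ∘ y) C δ` (what FILE 1's END delivers).
Asserts NO bound on any table; discharges NOTHING of (Q-L) ∕ (C) ∕ «T2Shape» ∕ «T2Drift» ∕ (hW, hWall); NEVER «G-an2-4 closed» as (CONV-C); NOT D1, NOT
`BetaPertH`, NOT continuum, NOT Clay; not in print.  Unit `b2b-balaban-gan24-formalise-leaf-03` (gen 67), 2026-08-23.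
-/

noncomputable section
open Finset
open scoped BigOperators
open Literature.MathematicalPhysics.QuantumFieldTheory
open Literature.MathematicalPhysics.QuantumFieldTheory.Balaban1983to89
open Literature.MathematicalPhysics.QuantumFieldTheory.Balaban1983to89.Beta
open B12Sec2to5 (l1)
open AffineAveraging (unitVec)
open AveragingWardStencils (b6UnitVec_eq)
open ExpKernelCalculus (MKer Site BiLoc)
open OneStepResolventKernel (Fib)
open BalabanCompositeJets (LocStencil₂)
open Summit.QuantumFields.BalabanUV.Beta.TameKernelCalculus (trK trK_apply)
open Summit.QuantumFields.BalabanUV.Beta.BorderedHessian (sgnF sgnF_inl sgnK sgnK_apply sgnK_sgnK)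
open Summit.QuantumFields.BalabanUV.Beta.SpineRecursiveParity (sgnK_smul trK_smul)
open Summit.QuantumFields.BalabanUV.Beta.GAN24.Lin4LegTower (rdiv rdiv_apply rdiv_smul)
open Summit.QuantumFields.BalabanUV.Beta.GAN24.Lin4LegTowerTwo (ldiv ldiv_apply)
open Summit.QuantumFields.BalabanUV.Beta.GAN24.BiTableParityHalves (sgnK_trK_apply abs_sgnF_mul_sgnF)
open Summit.QuantumFields.BalabanUV.Beta.GAN24.SecondOrderReadersParity (sgnK_trK_add sgnK_trK_smul sgnK_trK_sgnK_trK)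

namespace Summit.QuantumFields.BalabanUV.Beta.GAN24.LegLetterParity

variable {d : ℕ}

/-! ## §1 The letter-row lambdas are `−rdiv` ∕ `−ldiv` -/

/-- [folklore] **THE RIGHT-LEG LETTER LAMBDA IS `−rdiv`**: `Σ_β (Y s x p a (inl β) − Y s x (p − e_β) a (inl β)) = −(rdiv (Y s) x p a b)`, as tables. -/
theorem legLetterR_eq_neg_rdiv (Y : Fin (d + 1) → (Fin (d + 1) → ℤ) → Fin (d + 1) → (Fin (d + 1) → ℤ) → MKer (d + 1) (Fib d)) :
    (fun κ u κ' u' => fun (x p : Fin (d + 1) → ℤ) (a : Fib d) (_ : Fib d) =>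
      ∑ β : Fin (d + 1), (Y κ u κ' u' x p a (Sum.inl β) - Y κ u κ' u' x (p - unitVec β) a (Sum.inl β)))
      = -(fun κ u κ' u' => rdiv (Y κ u κ' u')) := by
  funext κ u κ' u' x p a b
  simp only [Pi.neg_apply, rdiv_apply, ← Finset.sum_neg_distrib, neg_sub, b6UnitVec_eq]

/-- [folklore] **THE LEFT-LEG LETTER LAMBDA IS `−ldiv`**: `Σ_β (Y s p z (inl β) b − Y s (p − e_β) z (inl β) b) = −(ldiv (Y s) p z a b)`, as tables. -/
theorem legLetterL_eq_neg_ldiv (Y : Fin (d + 1) → (Fin (d + 1) → ℤ) → Fin (d + 1) → (Fin (d + 1) → ℤ) → MKer (d + 1) (Fib d)) :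
    (fun κ u κ' u' => fun (p z : Fin (d + 1) → ℤ) (_ : Fib d) (b : Fib d) =>
      ∑ β : Fin (d + 1), (Y κ u κ' u' p z (Sum.inl β) b - Y κ u κ' u' (p - unitVec β) z (Sum.inl β) b))
      = -(fun κ u κ' u' => ldiv (Y κ u κ' u')) := by
  funext κ u κ' u' p z a b
  simp only [Pi.neg_apply, ldiv_apply, ← Finset.sum_neg_distrib, neg_sub, b6UnitVec_eq]

/-! ## §2 `LocStencil₂` is sign-blind; the letter rows are rows of `rdiv ∘ Y` ∕ `ldiv ∘ Y` -/

/-- [folklore] `LocStencil₂ X C δ ⟹ LocStencil₂ (−X) C δ`. -/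
theorem locStencil₂_neg {X : Fin (d + 1) → (Fin (d + 1) → ℤ) → Fin (d + 1) → (Fin (d + 1) → ℤ) → MKer (d + 1) (Fib d)} {C δ : ℝ}
    (h : LocStencil₂ X C δ) : LocStencil₂ (-X) C δ := by
  intro κ u κ' u' x z a b
  have e : (-X) κ u κ' u' x z a b = -(X κ u κ' u' x z a b) := rfl
  rw [e, abs_neg]
  exact h κ u κ' u' x z a b

/-- [folklore] **`LocStencil₂` IS SIGN-BLIND**: `LocStencil₂ (−X) C δ ↔ LocStencil₂ X C δ`. -/
theorem locStencil₂_neg_iff {X : Fin (d + 1) → (Fin (d + 1) → ℤ) → Fin (d + 1) → (Fin (d + 1) → ℤ) → MKer (d + 1) (Fib d)} {C δ : ℝ} :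
    LocStencil₂ (-X) C δ ↔ LocStencil₂ X C δ :=
  ⟨fun h => by simpa only [neg_neg] using locStencil₂_neg h, locStencil₂_neg⟩

/-- [folklore] **THE RIGHT-LEG LETTER ROW IS THE `LocStencil₂` ROW OF `rdiv ∘ Y`**, same constants. -/
theorem legRowR_iff_rdiv (Y : Fin (d + 1) → (Fin (d + 1) → ℤ) → Fin (d + 1) → (Fin (d + 1) → ℤ) → MKer (d + 1) (Fib d)) (C δ : ℝ) :
    LocStencil₂ (fun κ u κ' u' => fun (x p : Fin (d + 1) → ℤ) (a : Fib d) (_ : Fib d) =>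
      ∑ β : Fin (d + 1), (Y κ u κ' u' x p a (Sum.inl β) - Y κ u κ' u' x (p - unitVec β) a (Sum.inl β))) C δ
      ↔ LocStencil₂ (fun κ u κ' u' => rdiv (Y κ u κ' u')) C δ := by
  rw [legLetterR_eq_neg_rdiv, locStencil₂_neg_iff]

/-- [folklore] **THE LEFT-LEG LETTER ROW IS THE `LocStencil₂` ROW OF `ldiv ∘ Y`**, same constants. -/
theorem legRowL_iff_ldiv (Y : Fin (d + 1) → (Fin (d + 1) → ℤ) → Fin (d + 1) → (Fin (d + 1) → ℤ) → MKer (d + 1) (Fib d)) (C δ : ℝ) :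
    LocStencil₂ (fun κ u κ' u' => fun (p z : Fin (d + 1) → ℤ) (_ : Fib d) (b : Fib d) =>
      ∑ β : Fin (d + 1), (Y κ u κ' u' p z (Sum.inl β) b - Y κ u κ' u' (p - unitVec β) z (Sum.inl β) b)) C δ
      ↔ LocStencil₂ (fun κ u κ' u' => ldiv (Y κ u κ' u')) C δ := by
  rw [legLetterL_eq_neg_ldiv, locStencil₂_neg_iff]

/-! ## §3 Parity: the left-leg divergence of a parity kernel is the signed leg-transpose of its right-leg divergence -/

/-- [folklore] **`rdiv` OF A SIGN-CONJUGATED KERNEL**: the contracted right index is a FIELD leg (`sgnF (inl β) = 1`), so `rdiv (sgnK F) x p a b = sgnF a · rdiv F x p a b`. -/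
theorem rdiv_sgnK (F : MKer (d + 1) (Fib d)) (x p : Site (d + 1)) (a b : Fib d) :
    rdiv (sgnK F) x p a b = sgnF a * rdiv F x p a b := by
  simp only [rdiv_apply, sgnK_apply, sgnF_inl, mul_one, Finset.mul_sum, mul_sub]

/-- [folklore] **THE LEFT-LEG DIVERGENCE OF A PARITY KERNEL** (`sgnK (trK F) = ε • F`): `ldiv F x p a b = ε · (sgnF b · rdiv F p x b a)` — the signed leg-transpose of
the right-leg divergence (RULING R-gan24p1-g33-2 (4)-2 at one kernel). -/
theorem ldiv_of_parity {F : MKer (d + 1) (Fib d)} {ε : ℝ} (hF : sgnK (trK F) = ε • F) (x p : Site (d + 1)) (a b : Fib d) :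
    ldiv F x p a b = ε * (sgnF b * rdiv F p x b a) := by
  -- `trK F = ε • sgnK F`
  have htr : trK F = ε • sgnK F := by
    have h := congrArg sgnK hF
    rw [sgnK_sgnK, sgnK_smul] at h
    exact h
  show trK (rdiv (trK F)) x p a b = _
  rw [htr, rdiv_smul, trK_smul, Pi.smul_apply, Pi.smul_apply, Pi.smul_apply, Pi.smul_apply, smul_eq_mul, trK_apply, rdiv_sgnK]

/-- [folklore] **IN ABSOLUTE VALUE** (`|ε| ≤ 1`): `|ldiv F x p a b| ≤ |rdiv F p x b a|`. -/
theorem abs_ldiv_le_of_parity {F : MKer (d + 1) (Fib d)} {ε : ℝ} (hF : sgnK (trK F) = ε • F) (hε : |ε| ≤ 1) (x p : Site (d + 1)) (a b : Fib d) :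
    |ldiv F x p a b| ≤ |rdiv F p x b a| := by
  rw [ldiv_of_parity hF, abs_mul, abs_mul]
  have hb : |sgnF (d := d) b| = 1 := by rcases b with κ | κ <;> simp
  rw [hb, one_mul]
  calc |ε| * |rdiv F p x b a| ≤ 1 * |rdiv F p x b a| := mul_le_mul_of_nonneg_right hε (abs_nonneg _)
    _ = |rdiv F p x b a| := one_mul _

/-- NOT IN PRINT; OUR BOOKKEEPING.  **ONE LEG TOWER PER PARITY FAMILY**: if every kernel of the family is a parity kernel with the same sign, `sgnK (trK (Y s)) = ε • Y s`
(`|ε| ≤ 1`), then `LocStencil₂ (rdiv ∘ Y) C δ ⟹ LocStencil₂ (ldiv ∘ Y) C δ` with the SAME constants (the weight `e^{−δ(|x−u|₁+|z−u|₁)}` is leg-symmetric). -/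
theorem locStencil₂_ldiv_of_parity {Y : Fin (d + 1) → (Fin (d + 1) → ℤ) → Fin (d + 1) → (Fin (d + 1) → ℤ) → MKer (d + 1) (Fib d)} {ε C δ : ℝ}
    (hY : ∀ κ u κ' u', sgnK (trK (Y κ u κ' u')) = ε • Y κ u κ' u') (hε : |ε| ≤ 1) (h : LocStencil₂ (fun κ u κ' u' => rdiv (Y κ u κ' u')) C δ) :
    LocStencil₂ (fun κ u κ' u' => ldiv (Y κ u κ' u')) C δ := by
  intro κ u κ' u' x z a b
  refine (abs_ldiv_le_of_parity (hY κ u κ' u') hε x z a b).trans ?_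
  have h1 := h κ u κ' u' z x b a
  rwa [add_comm (l1 (z - u))] at h1

/-! ## §4 The `ε`-member `½ • (X + ε • P X)` and the economy `hL₁ ⟸ hL₂` -/

/-- [folklore] **THE `ε`-MEMBER IS A PARITY FAMILY WITH SIGN `ε`** (`ε·ε = 1`): for `y := ½ • (X + ε • P X)` (`P X s := sgnK (trK (X s))`),
`sgnK (trK (y s)) = ε • y s` for every slot `s`. -/
theorem parity_halfTable (X : Fin (d + 1) → (Fin (d + 1) → ℤ) → Fin (d + 1) → (Fin (d + 1) → ℤ) → MKer (d + 1) (Fib d)) {ε : ℝ} (hε : ε * ε = 1)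
    (κ : Fin (d + 1)) (u : Fin (d + 1) → ℤ) (κ' : Fin (d + 1)) (u' : Fin (d + 1) → ℤ) :
    sgnK (trK ((((1 : ℝ) / 2) • (X + ε • fun κ u κ' u' => sgnK (trK (X κ u κ' u')))) κ u κ' u'))
      = ε • (((1 : ℝ) / 2) • (X + ε • fun κ u κ' u' => sgnK (trK (X κ u κ' u')))) κ u κ' u' := by
  have e : (((1 : ℝ) / 2) • (X + ε • fun κ u κ' u' => sgnK (trK (X κ u κ' u')))) κ u κ' u'
      = ((1 : ℝ) / 2) • (X κ u κ' u' + ε • sgnK (trK (X κ u κ' u'))) := rfl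
  rw [e, sgnK_trK_smul, sgnK_trK_add, sgnK_trK_smul, sgnK_trK_sgnK_trK]
  funext x z a b
  simp only [Pi.smul_apply, Pi.add_apply, smul_eq_mul]
  linear_combination (-((1 : ℝ) / 2) * sgnK (trK (X κ u κ' u')) x z a b) * hε

/-- NOT IN PRINT; OUR BOOKKEEPING.  **THE ECONOMY `hL₁ ⟸ hL₂` FOR THE `ε`-MEMBER** (`ε·ε = 1`; FILE 3c's ∕ leaf-01 PART C's EXACT letter-row lambdas at
`y := ½ • (X + ε • P X)`): the RIGHT-leg letter row with constant `C` at rate `δ` implies the LEFT-leg letter row with the SAME `C`, `δ`. -/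
theorem legRowL_of_legRowR_half (X : Fin (d + 1) → (Fin (d + 1) → ℤ) → Fin (d + 1) → (Fin (d + 1) → ℤ) → MKer (d + 1) (Fib d)) {ε : ℝ} (hε : ε * ε = 1)
    {C δ : ℝ}
    (hR : LocStencil₂ (fun κ u κ' u' => fun (x p : Fin (d + 1) → ℤ) (a : Fib d) (_ : Fib d) =>
      ∑ β : Fin (d + 1), ((((1 : ℝ) / 2) • (X + ε • fun κ u κ' u' => sgnK (trK (X κ u κ' u')))) κ u κ' u' x p a (Sum.inl β)
        - (((1 : ℝ) / 2) • (X + ε • fun κ u κ' u' => sgnK (trK (X κ u κ' u')))) κ u κ' u' x (p - unitVec β) a (Sum.inl β))) C δ) :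
    LocStencil₂ (fun κ u κ' u' => fun (p z : Fin (d + 1) → ℤ) (_ : Fib d) (b : Fib d) =>
      ∑ β : Fin (d + 1), ((((1 : ℝ) / 2) • (X + ε • fun κ u κ' u' => sgnK (trK (X κ u κ' u')))) κ u κ' u' p z (Sum.inl β) b
        - (((1 : ℝ) / 2) • (X + ε • fun κ u κ' u' => sgnK (trK (X κ u κ' u')))) κ u κ' u' (p - unitVec β) z (Sum.inl β) b)) C δ := by
  have hε1 : |ε| ≤ 1 := by
    have h : |ε| * |ε| = 1 := by rw [← abs_mul, hε, abs_one]
    nlinarith [abs_nonneg ε]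
  rw [legRowL_iff_ldiv]
  rw [legRowR_iff_rdiv] at hR
  exact locStencil₂_ldiv_of_parity (fun κ u κ' u' => parity_halfTable X hε κ u κ' u') hε1 hR

/-- NOT IN PRINT; OUR BOOKKEEPING.  **BOTH LETTER ROWS OF THE `ε`-MEMBER FROM ONE `rdiv` ROW** (`ε·ε = 1`): `LocStencil₂ (fun s ↦ rdiv (y s)) C δ` (what FILE 1
`LegTowerSlavedRows.locStencil₂_rdiv_tower_of_window_slaved_comb` delivers, level by level) ⟹ the LEFT-leg row `hL₁` ∧ the RIGHT-leg row `hL₂` of `y := ½ • (X + ε • P X)`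
in FILE 3c's EXACT lambda spellings, SAME `C`, `δ`. -/
theorem legRows_of_rdiv_half (X : Fin (d + 1) → (Fin (d + 1) → ℤ) → Fin (d + 1) → (Fin (d + 1) → ℤ) → MKer (d + 1) (Fib d)) {ε : ℝ} (hε : ε * ε = 1)
    {C δ : ℝ} (h : LocStencil₂ (fun κ u κ' u' => rdiv ((((1 : ℝ) / 2) • (X + ε • fun κ u κ' u' => sgnK (trK (X κ u κ' u')))) κ u κ' u')) C δ) :
    LocStencil₂ (fun κ u κ' u' => fun (p z : Fin (d + 1) → ℤ) (_ : Fib d) (b : Fib d) =>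
      ∑ β : Fin (d + 1), ((((1 : ℝ) / 2) • (X + ε • fun κ u κ' u' => sgnK (trK (X κ u κ' u')))) κ u κ' u' p z (Sum.inl β) b
        - (((1 : ℝ) / 2) • (X + ε • fun κ u κ' u' => sgnK (trK (X κ u κ' u')))) κ u κ' u' (p - unitVec β) z (Sum.inl β) b)) C δ ∧
    LocStencil₂ (fun κ u κ' u' => fun (x p : Fin (d + 1) → ℤ) (a : Fib d) (_ : Fib d) =>
      ∑ β : Fin (d + 1), ((((1 : ℝ) / 2) • (X + ε • fun κ u κ' u' => sgnK (trK (X κ u κ' u')))) κ u κ' u' x p a (Sum.inl β)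
        - (((1 : ℝ) / 2) • (X + ε • fun κ u κ' u' => sgnK (trK (X κ u κ' u')))) κ u κ' u' x (p - unitVec β) a (Sum.inl β))) C δ := by
  have hR : LocStencil₂ (fun κ u κ' u' => fun (x p : Fin (d + 1) → ℤ) (a : Fib d) (_ : Fib d) =>
      ∑ β : Fin (d + 1), ((((1 : ℝ) / 2) • (X + ε • fun κ u κ' u' => sgnK (trK (X κ u κ' u')))) κ u κ' u' x p a (Sum.inl β)
        - (((1 : ℝ) / 2) • (X + ε • fun κ u κ' u' => sgnK (trK (X κ u κ' u')))) κ u κ' u' x (p - unitVec β) a (Sum.inl β))) C δ := by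
    rw [legRowR_iff_rdiv]
    exact h
  exact ⟨legRowL_of_legRowR_half X hε hR, hR⟩

end Summit.QuantumFields.BalabanUV.Beta.GAN24.LegLetterParity
end
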